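import Literature.MathematicalPhysics.QuantumFieldTheory.King1986.MinimizerAliasRateFactor
import Literature.MathematicalPhysics.QuantumFieldTheory.King1986.MinimizerTwoSpacingDeriv
import HarnessLib

/-!
# King 1986, Proposition 3.8 (3.71), THIRD AND FOURTH LINES — the HÖLDER QUOTIENT `∂_α(x, y)` of the block-spin minimiser
# kernel and of its lattice derivative — ON THE TORUS for the ACTUAL operators, sup-norm two-spacing rates:
# `|(∂_α(x′,y′)a_{k+n}G^{η′}_{k+n}Q^*_{k+n})(z) − (∂_α(x,y)a_kG^η_kQ^*_k)(z)| ≦ CL^{−γk}` and the same with `∂^η_μ` inside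

**Citation header (reproduction of PUBLISHED and PROVED work; seat `pub-ymgap-dag-n18-b` (g2) of the cell `pub-ymgap`,
Track-A node N18 = NE5 whose PRINTED MODEL of record is King's Prop. 3.8 ∕ 3.9; twelfth file of the seat's chain — the two
instances `β = α` and `β = 1 + α` of the general-factor momentum-space core `MinimizerAliasRateFactor`, assembled on the
torus as in `MinimizerTwoSpacing` ∕ `MinimizerTwoSpacingDeriv`, with the Hölder-quotient displays (4.26)–(4.28) of the
tree's `AveragingWeightRateHolder` (`holder_428c_core`, `norm_cexp_sub_cexp_le_rpow`) supplying the factor bounds.)**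
C. King, *The U(1) Higgs model. I. The continuum limit*, Commun. Math. Phys. **102** (1986) 649–677 [King1986], §3.4
(3.62) p. 663 «(∂_α(x, y)G)(z) = |x − y|^{−α}{G(x, z) − G(y, z)}», Proposition 3.8 (3.71) p. 664, lines 3–4; §4 (4.19)
p. 672, (4.26)–(4.28) p. 673.  Page images READ AS IMAGES by this seat: `b2b-balaban-template/king-renders/1986-cmp102-
king-u1-higgs-I-p016-x2.png` (p. 664), `…-p024-x2.png` (p. 672), `…-p025-x2.png` (p. 673).  King's paper is TEMPLATE
LITERATURE (printed and proved `A = 0` mechanism); nothing here is about Bałaban's covariant objects.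

**What King prints (verbatim).**  p. 663: «For a propagator G(x, y), we define a "Hölder derivative" by (∂_α(x, y)G)(z) =
|x − y|^{−α}{G(x, z) − G(y, z)}. (3.62)»  p. 672: «|x′ − y′|^{−α}|1 − exp[i(p′+l+m)(y′−x′)]| ≦ C|p′+l+m|^α, so the sum over
l, m is bounded by Σ_{l,m}|p′+l+m|^{α−1}Π_μ|(p′+l+m)_μ|^{−1} ≦ C for α < 1. (4.22)»  p. 673: «For the Hölder derivatives,
suppose |x − y| ≦ L^{−k}. Then |x − y|^{−α}|1 − exp[i(p′+l)(y − x)]| ≦ C|p′+l|^{α+γ}|x − y|^γ ≦ CL^{−γk}|p′+l|^{α+γ}. (4.26)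
Furthermore, when |x − y| > L^{−k}, we have ||x − y| − |x′ − y′|| ≦ L^{−k}. (4.27) Therefore it follows easily that
||x − y|^{−α}{1 − exp[i(p′+l)(y − x)]} − |x′ − y′|^{−α}{1 − exp[i(p′+l)(y′ − x′)]}| ≦ CL^{−γk}|p′+l|^{α+γ}, (4.28) where we
have assumed α + γ < 1 and γ ≦ α.»

**What this file PROVES (kernel; 0 `sorry`).**  On the torus `Tor (fine N M)` (`N = L^k`) the Hölder quotient is taken
in the SUP torus distance in unit-lattice coordinates, `ρ_N(x, y) = tdistT (fine N M) x y ∕ N` (`holdist`), and the phase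
`e^{iQ·(y − x)}` is read through the CENTRED integer representative `v(y − x)` (`cdiff`; `urep = v∕N`, `‖urep‖_∞ ≤ ρ_N`):
* §1 the Hölder factor `holderFac α ρ u Q = ρ^{−α}(1 − e^{iQ·u})` in momentum space: size `≤ 2d^α‖Q‖^α` (the p. 672
  display, `norm_holderFac_le`) and the TWO-PAIR replacement `≤ 6d^{α+γ}‖Q‖^{α+γ}ε^γ` whenever `|ρ′ − ρ| ≤ ε` and `u′` has
  the same phase as a vector within `ε` of `u` ((4.27)–(4.28) through `holder_428c_core` with sup-norm data,
  `norm_holderFac_sub_le`).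
* §2 torus bookkeeping: characters through ARBITRARY integer representatives (`chi_eq_cexp_of_rep`), `cdiff` ∕ `urep` ∕
  `holdist` ∕ `upos`, `norm_urep_le`, the alias phases are `M`-periodic in the position (`cexp_aliasPt_dot_add_period`),
  `modePhase_pos_eq_mul` (the mode at `y` is the mode at `x` times `e^{iQ·urep}`), and the TWO-LATTICE GEOMETRY for
  `x′, y′` over `x, y` (`x_ν = ⌊x′_ν∕R⌋`): the representative `urepOver` of `y′ − x′` within `N⁻¹` of `urep x y`
  (`norm_urepOver_sub_le`), congruent to the centred one (`cexp_dot_urepOver`), and `|ρ′ − ρ| ≤ N⁻¹` (`abs_holdist_sub_le`).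
* §3 the Hölder quotients of the minimiser kernel and of its derivative as King's digit sums (4.19) with the factor
  `|x − y|^{−α}{1 − exp[iQ(y − x)]}` (`holder_kernel_eq_digitSum`, `holder_dkernel_eq_digitSum`).
* §4 the abstract torus assembly `factor_two_spacing_torus` (any factor families obeying King's two bounds at the alias
  momenta ⇒ `|F_B − F_A| ≤ (C₁^E + C₂^E)N^{−γ}`), and the two instances **`king_prop38_holder_torus`** (line 3:
  `|ρ′^{−α}(ℋ_{k+n}(x′,b) − ℋ_{k+n}(y′,b)) − ρ^{−α}(ℋ_k(x,b) − ℋ_k(y,b))| ≤ (C₁ + C₂)L^{−γk}`, `0 ≤ α`, `0 < γ`, `α + γ ≤ 1`)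
  and **`king_prop38_holder_deriv_torus`** (line 4, `∂^η_μ` inside, `α + γ < 1`), uniform in the points, the unit torus,
  the mass and `n`.

**NOT COVERED.**  The exponential factor `exp[−δ₀dist({x, y}, z)]` of (3.71) for these two lines («combining with
Theorem 3.3», whose Hölder clause (3.8) is not transported to the tree); Euclidean in place of sup distances (immaterial
up to `d`-dependent constants); even `L`; `A ≠ 0`.  HONEST FRAMING: King's `A = 0` scalar MODEL of the NE5 mechanism —
template literature on a finite torus; nothing about Bałaban's covariant objects; nothing continuum ∕ mass-gap ∕ Clay;
count-neutral for the cell's 27 nodes.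
-/

noncomputable section

open Finset Real Matrix
open scoped BigOperators ComplexConjugate

namespace Literature.MathematicalPhysics.QuantumFieldTheory.King1986

open Literature.MathematicalPhysics.QuantumFieldTheory.Balaban1983to89.B5Prop11Plancherel
open Literature.MathematicalPhysics.QuantumFieldTheory.Balaban1983to89.B4TorusKernel.MultiPeriod
  (circAbs circAbs_le_abs circAbs_add_mul)
open Literature.MathematicalPhysics.QuantumFieldTheory.Balaban1983to89.B4Sect5Torus (circAbs_neg circAbs_add_le)
open Literature.MathematicalPhysics.QuantumFieldTheory.Balaban1983to89.B5Ineq137Torus (circAbs_mul_mul)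

/-! ## §1 The Hölder factor in momentum space (sup-norm currency) -/

/-- King's Hölder factor of (4.19) in unit-lattice coordinates: `ρ^{−α}·{1 − exp[iQ·u]}` for a position difference
`u` (`= y − x`) of sup-size `≤ ρ` (`= |x − y|`). [cite: King1986, (3.62) p.663, (4.19) p.672] -/
def holderFac {d : ℕ} (α ρ : ℝ) (u Q : Fin d → ℝ) : ℂ :=
  ((ρ ^ (-α) : ℝ) : ℂ) * (1 - Complex.exp (Complex.I * ((∑ μ, Q μ * u μ : ℝ) : ℂ)))

/-- `Σ_μ |q_μ| ≤ d·‖q‖` (sup norm). [folklore] -/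
private theorem sum_abs_le_card_mul_norm' {d : ℕ} (q : Fin d → ℝ) : ∑ μ, |q μ| ≤ d * ‖q‖ := by
  have h : ∀ μ ∈ (Finset.univ : Finset (Fin d)), |q μ| ≤ ‖q‖ := fun μ _ => by
    rw [← Real.norm_eq_abs]; exact norm_le_pi_norm q μ
  calc ∑ μ, |q μ| ≤ ∑ _μ : Fin d, ‖q‖ := Finset.sum_le_sum h
    _ = d * ‖q‖ := by rw [Finset.sum_const, Finset.card_univ, Fintype.card_fin, nsmul_eq_mul]

/-- `|Q·u| ≤ d‖Q‖‖u‖` (sup norms). [folklore] -/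
private theorem abs_dot_le_norm {d : ℕ} (Q u : Fin d → ℝ) : |∑ μ, Q μ * u μ| ≤ d * ‖Q‖ * ‖u‖ := by
  calc |∑ μ, Q μ * u μ| ≤ ∑ μ, |Q μ * u μ| := Finset.abs_sum_le_sum_abs _ _
    _ = ∑ μ, |Q μ| * |u μ| := Finset.sum_congr rfl fun μ _ => abs_mul _ _
    _ ≤ ∑ μ, |Q μ| * ‖u‖ := Finset.sum_le_sum fun μ _ =>
        mul_le_mul_of_nonneg_left (by rw [← Real.norm_eq_abs]; exact norm_le_pi_norm u μ) (abs_nonneg _)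
    _ = (∑ μ, |Q μ|) * ‖u‖ := by rw [Finset.sum_mul]
    _ ≤ d * ‖Q‖ * ‖u‖ := mul_le_mul_of_nonneg_right (sum_abs_le_card_mul_norm' Q) (norm_nonneg _)

/-- The phase factor of the Hölder quotient: `‖1 − e^{iQ·u}‖ ≤ 2(d‖Q‖‖u‖)^s` for `0 ≤ s ≤ 1` ((4.24)'s first inequality
at one endpoint, `norm_cexp_sub_cexp_le_rpow`). [cite: King1986, (4.26) p.673] -/
theorem norm_one_sub_cexp_dot_le {d : ℕ} (Q u : Fin d → ℝ) {s : ℝ} (hs0 : 0 ≤ s) (hs1 : s ≤ 1) :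
    ‖1 - Complex.exp (Complex.I * ((∑ μ, Q μ * u μ : ℝ) : ℂ))‖ ≤ 2 * ((d : ℝ) * ‖Q‖ * ‖u‖) ^ s := by
  have h := norm_cexp_sub_cexp_le_rpow 0 (∑ μ, Q μ * u μ) hs0 hs1
  simp only [Complex.ofReal_zero, mul_zero, Complex.exp_zero, zero_sub, abs_neg] at h
  exact h.trans (mul_le_mul_of_nonneg_left (Real.rpow_le_rpow (abs_nonneg _) (abs_dot_le_norm Q u) hs0) zero_le_two)

/-- **The size of the Hölder factor** (p. 672: «|x′ − y′|^{−α}|1 − exp[i(p′+l+m)(y′−x′)]| ≦ C|p′+l+m|^α»): for `‖u‖ ≤ ρ`,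
`0 ≤ α ≤ 1`: `‖ρ^{−α}(1 − e^{iQ·u})‖ ≤ 2d^α·‖Q‖^α`. [cite: King1986, p.672 (display after (4.21)); (4.26) p.673] -/
theorem norm_holderFac_le {d : ℕ} {α : ℝ} (hα0 : 0 ≤ α) (hα1 : α ≤ 1) {ρ : ℝ} {u : Fin d → ℝ} (hρ : ‖u‖ ≤ ρ)
    (Q : Fin d → ℝ) : ‖holderFac α ρ u Q‖ ≤ 2 * (d : ℝ) ^ α * ‖Q‖ ^ α := by
  have hρ0 : 0 ≤ ρ := (norm_nonneg u).trans hρ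
  unfold holderFac
  rw [norm_mul, Complex.norm_real, Real.norm_eq_abs, abs_of_nonneg (Real.rpow_nonneg hρ0 _)]
  rcases hρ0.eq_or_lt with h0 | hpos
  · -- ρ = 0: u = 0 and the phase factor vanishes
    have hu : u = 0 := by
      have : ‖u‖ ≤ 0 := by rw [h0]; exact hρ
      exact norm_le_zero_iff.mp this
    subst hu
    have hnn : (0 : ℝ) ≤ 2 * (d : ℝ) ^ α * ‖Q‖ ^ α := by positivity
    simpa using hnn
  · have h1 := norm_one_sub_cexp_dot_le Q u hα0 hα1
    have h2 : ((d : ℝ) * ‖Q‖ * ‖u‖) ^ α ≤ ((d : ℝ) * ‖Q‖ * ρ) ^ α :=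
      Real.rpow_le_rpow (by positivity) (mul_le_mul_of_nonneg_left hρ (by positivity)) hα0
    calc ρ ^ (-α) * ‖1 - Complex.exp (Complex.I * ((∑ μ, Q μ * u μ : ℝ) : ℂ))‖
        ≤ ρ ^ (-α) * (2 * ((d : ℝ) * ‖Q‖ * ρ) ^ α) :=
          mul_le_mul_of_nonneg_left (h1.trans (mul_le_mul_of_nonneg_left h2 zero_le_two)) (Real.rpow_nonneg hρ0 _)
      _ = 2 * (d : ℝ) ^ α * ‖Q‖ ^ α * (ρ ^ (-α) * ρ ^ α) := by
          rw [Real.mul_rpow (by positivity) hρ0, Real.mul_rpow (Nat.cast_nonneg d) (norm_nonneg Q)]; ring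
      _ = 2 * (d : ℝ) ^ α * ‖Q‖ ^ α := by
          rw [← Real.rpow_add hpos, neg_add_cancel, Real.rpow_zero, mul_one]

/-- **(4.27)–(4.28) in sup-norm currency — the two-pair replacement of the Hölder factor**: sizes `ρ, ρ′ ≥ 0` with
`|ρ′ − ρ| ≤ ε`, vectors `‖u‖ ≤ ρ`, `‖u′‖ ≤ ρ′`, and a vector `u″` with the SAME phase as `u′` (`e^{iQ·u″} = e^{iQ·u′}`) and
`‖u″ − u‖ ≤ ε` (`ε > 0`, `0 ≤ α`, `0 < γ`, `α + γ ≤ 1`): `‖ρ′^{−α}(1 − e^{iQ·u′}) − ρ^{−α}(1 − e^{iQ·u})‖ ≤ 6d^{α+γ}‖Q‖^{α+γ}ε^γ`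
— `holder_428c_core` with `a = ρ′`, `b = ρ`, `H = 2(d‖Q‖)^{α+γ}`. [cite: King1986, (4.27)–(4.28) p.673] -/
theorem norm_holderFac_sub_le {d : ℕ} {α γ : ℝ} (hα : 0 ≤ α) (hγ : 0 < γ) (hαγ : α + γ ≤ 1)
    {ρ ρ' ε : ℝ} (hρ : 0 ≤ ρ) (hρ' : 0 ≤ ρ') (hε : 0 < ε) (hab : |ρ' - ρ| ≤ ε)
    {u u' u'' : Fin d → ℝ} (hu : ‖u‖ ≤ ρ) (hu' : ‖u'‖ ≤ ρ') (Q : Fin d → ℝ)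
    (hper : Complex.exp (Complex.I * ((∑ μ, Q μ * u'' μ : ℝ) : ℂ))
      = Complex.exp (Complex.I * ((∑ μ, Q μ * u' μ : ℝ) : ℂ)))
    (hclose : ‖u'' - u‖ ≤ ε) :
    ‖holderFac α ρ' u' Q - holderFac α ρ u Q‖ ≤ 6 * (d : ℝ) ^ (α + γ) * ‖Q‖ ^ (α + γ) * ε ^ γ := by
  have hs0 : 0 ≤ α + γ := by linarith
  set H : ℝ := 2 * ((d : ℝ) * ‖Q‖) ^ (α + γ) with hH_def
  have hH : 0 ≤ H := by positivity
  set P : ℂ := 1 - Complex.exp (Complex.I * ((∑ μ, Q μ * u' μ : ℝ) : ℂ)) with hP_def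
  set P' : ℂ := 1 - Complex.exp (Complex.I * ((∑ μ, Q μ * u μ : ℝ) : ℂ)) with hP'_def
  have hsize : ∀ (v : Fin d → ℝ) (r : ℝ), ‖v‖ ≤ r →
      ‖1 - Complex.exp (Complex.I * ((∑ μ, Q μ * v μ : ℝ) : ℂ))‖ ≤ H * r ^ (α + γ) := by
    intro v r hv
    have hr : 0 ≤ r := (norm_nonneg v).trans hv
    have h1 := norm_one_sub_cexp_dot_le Q v hs0 hαγ
    have h2 : ((d : ℝ) * ‖Q‖ * ‖v‖) ^ (α + γ) ≤ ((d : ℝ) * ‖Q‖ * r) ^ (α + γ) :=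
      Real.rpow_le_rpow (by positivity) (mul_le_mul_of_nonneg_left hv (by positivity)) hs0
    calc _ ≤ 2 * ((d : ℝ) * ‖Q‖ * r) ^ (α + γ) := h1.trans (mul_le_mul_of_nonneg_left h2 zero_le_two)
      _ = H * r ^ (α + γ) := by rw [hH_def, Real.mul_rpow (by positivity) hr]; ring
  have hP : ‖P‖ ≤ H * ρ' ^ (α + γ) := hsize u' ρ' hu'
  have hP' : ‖P'‖ ≤ H * ρ ^ (α + γ) := hsize u ρ hu
  have hPP : ‖P - P'‖ ≤ H * ε ^ (α + γ) := by
    have hid : P - P' = Complex.exp (Complex.I * ((∑ μ, Q μ * u μ : ℝ) : ℂ))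
        - Complex.exp (Complex.I * ((∑ μ, Q μ * u'' μ : ℝ) : ℂ)) := by
      rw [hP_def, hP'_def, ← hper]; ring
    rw [hid]
    have h1 := norm_cexp_sub_cexp_le_rpow (∑ μ, Q μ * u μ) (∑ μ, Q μ * u'' μ) hs0 hαγ
    have h2 : |∑ μ, Q μ * u μ - ∑ μ, Q μ * u'' μ| ≤ (d : ℝ) * ‖Q‖ * ε := by
      rw [← Finset.sum_sub_distrib]
      have : ∑ μ, (Q μ * u μ - Q μ * u'' μ) = ∑ μ, Q μ * (u - u'') μ :=
        Finset.sum_congr rfl fun μ _ => by rw [Pi.sub_apply, mul_sub]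
      rw [this]
      refine (abs_dot_le_norm Q (u - u'')).trans (mul_le_mul_of_nonneg_left ?_ (by positivity))
      rwa [norm_sub_rev]
    calc _ ≤ 2 * |∑ μ, Q μ * u μ - ∑ μ, Q μ * u'' μ| ^ (α + γ) := h1
      _ ≤ 2 * ((d : ℝ) * ‖Q‖ * ε) ^ (α + γ) :=
          mul_le_mul_of_nonneg_left (Real.rpow_le_rpow (abs_nonneg _) h2 hs0) zero_le_two
      _ = H * ε ^ (α + γ) := by rw [hH_def, Real.mul_rpow (by positivity) hε.le]; ring
  have h := holder_428c_core (V := ℂ) hα hγ hαγ hε hH hρ' hρ hab hP hP' hPP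
  rw [Complex.real_smul, Complex.real_smul] at h
  have hfin : 3 * H * ε ^ γ = 6 * (d : ℝ) ^ (α + γ) * ‖Q‖ ^ (α + γ) * ε ^ γ := by
    rw [hH_def, Real.mul_rpow (Nat.cast_nonneg d) (norm_nonneg Q)]; ring
  unfold holderFac
  rw [← hfin]
  exact h

/-- **The fourth line's factor** — Hölder quotient × derivative factor: `‖η⁻¹(e^{iηQ_μ} − 1)·ρ^{−α}(1 − e^{iQ·u})‖ ≤
2d^α·‖Q‖^{α+1}` (`‖u‖ ≤ ρ`, `0 ≤ α ≤ 1`). [cite: King1986, p.672 (displays after (4.21))] -/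
theorem norm_fdq_mul_holderFac_le {d : ℕ} {η : ℝ} (hη : 0 < η) {α : ℝ} (hα0 : 0 ≤ α) (hα1 : α ≤ 1) {ρ : ℝ}
    {u : Fin d → ℝ} (hρ : ‖u‖ ≤ ρ) (Q : Fin d → ℝ) (μ : Fin d) :
    ‖fdq η (-(Q μ)) * holderFac α ρ u Q‖ ≤ 2 * (d : ℝ) ^ α * ‖Q‖ ^ (α + 1) := by
  rw [norm_mul]
  have h1 : ‖fdq η (-(Q μ))‖ ≤ ‖Q‖ :=
    (norm_fdq_neg_le hη (Q μ)).trans (by rw [← Real.norm_eq_abs]; exact norm_le_pi_norm Q μ)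
  have h2 := norm_holderFac_le hα0 hα1 hρ Q
  calc ‖fdq η (-(Q μ))‖ * ‖holderFac α ρ u Q‖ ≤ ‖Q‖ * (2 * (d : ℝ) ^ α * ‖Q‖ ^ α) :=
        mul_le_mul h1 h2 (norm_nonneg _) (norm_nonneg _)
    _ = 2 * (d : ℝ) ^ α * (‖Q‖ ^ α * ‖Q‖ ^ (1 : ℝ)) := by rw [Real.rpow_one]; ring
    _ = 2 * (d : ℝ) ^ α * ‖Q‖ ^ (α + 1) := by
        rw [← Real.rpow_add' (norm_nonneg Q) (by linarith : α + 1 ≠ 0)]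

/-- **The fourth line's replacement**: with the data of `norm_holderFac_sub_le` and `0 < η′ ≤ η = N⁻¹`,
`‖D_{η′}h′ − D_ηh‖ ≤ ‖D_{η′}‖‖h′ − h‖ + ‖h‖‖D_{η′} − D_η‖ ≤ (2d^α2^{1−γ}·N^{−γ} + 6d^{α+γ}·ε^γ)·‖Q‖^{α+1+γ}` ((4.25) for the
derivative factor, (4.28) for the Hölder factor). [cite: King1986, (4.25) p.673, (4.28) p.673] -/
theorem norm_fdq_mul_holderFac_sub_le {d : ℕ} {N : ℝ} (hN : 0 < N) {η' : ℝ} (hη' : 0 < η') (hη'N : η' ≤ N⁻¹)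
    {α γ : ℝ} (hα : 0 ≤ α) (hγ : 0 < γ) (hαγ : α + γ ≤ 1)
    {ρ ρ' ε : ℝ} (hρ : 0 ≤ ρ) (hρ' : 0 ≤ ρ') (hε : 0 < ε) (hab : |ρ' - ρ| ≤ ε)
    {u u' u'' : Fin d → ℝ} (hu : ‖u‖ ≤ ρ) (hu' : ‖u'‖ ≤ ρ') (Q : Fin d → ℝ)
    (hper : Complex.exp (Complex.I * ((∑ μ, Q μ * u'' μ : ℝ) : ℂ))
      = Complex.exp (Complex.I * ((∑ μ, Q μ * u' μ : ℝ) : ℂ)))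
    (hclose : ‖u'' - u‖ ≤ ε) (μ : Fin d) :
    ‖fdq η' (-(Q μ)) * holderFac α ρ' u' Q - fdq N⁻¹ (-(Q μ)) * holderFac α ρ u Q‖
      ≤ (2 * (d : ℝ) ^ α * 2 ^ (1 - γ) * N ^ (-γ) + 6 * (d : ℝ) ^ (α + γ) * ε ^ γ) * ‖Q‖ ^ (α + 1 + γ) := by
  have hη : 0 < N⁻¹ := inv_pos.mpr hN
  have hγ1 : γ ≤ 1 := by linarith
  have hα1 : α ≤ 1 := by linarith
  have hNγ : 0 ≤ N ^ (-γ) := Real.rpow_nonneg hN.le _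
  have hεγ : 0 ≤ ε ^ γ := Real.rpow_nonneg hε.le _
  rcases (norm_nonneg Q).eq_or_lt with hQ0 | hQpos
  · -- Q = 0: both factors vanish
    have hQ : Q = 0 := norm_eq_zero.mp hQ0.symm
    subst hQ
    simp [holderFac, fdq]
    positivity
  · have hid : fdq η' (-(Q μ)) * holderFac α ρ' u' Q - fdq N⁻¹ (-(Q μ)) * holderFac α ρ u Q
        = fdq η' (-(Q μ)) * (holderFac α ρ' u' Q - holderFac α ρ u Q)
          + holderFac α ρ u Q * (fdq η' (-(Q μ)) - fdq N⁻¹ (-(Q μ))) := by ring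
    rw [hid]
    have hQμ : |Q μ| ≤ ‖Q‖ := by rw [← Real.norm_eq_abs]; exact norm_le_pi_norm Q μ
    have h1 : ‖fdq η' (-(Q μ))‖ ≤ ‖Q‖ := (norm_fdq_neg_le hη' (Q μ)).trans hQμ
    have h2 := norm_holderFac_sub_le hα hγ hαγ hρ hρ' hε hab hu hu' Q hper hclose
    have h3 := norm_holderFac_le hα hα1 hu Q
    have h4 := norm_fdq_two_spacing_le hN hη' hη'N hγ.le hγ1 hQpos hQμ
    have hp1 : ‖Q‖ * ‖Q‖ ^ (α + γ) = ‖Q‖ ^ (α + 1 + γ) := by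
      rw [← Real.rpow_one_add' (norm_nonneg Q) (by linarith : 1 + (α + γ) ≠ 0)]; congr 1; ring
    have hp2 : ‖Q‖ ^ α * ‖Q‖ ^ (1 + γ) = ‖Q‖ ^ (α + 1 + γ) := by
      rw [← Real.rpow_add hQpos]; congr 1; ring
    calc ‖fdq η' (-(Q μ)) * (holderFac α ρ' u' Q - holderFac α ρ u Q)
          + holderFac α ρ u Q * (fdq η' (-(Q μ)) - fdq N⁻¹ (-(Q μ)))‖
        ≤ ‖fdq η' (-(Q μ))‖ * ‖holderFac α ρ' u' Q - holderFac α ρ u Q‖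
          + ‖holderFac α ρ u Q‖ * ‖fdq η' (-(Q μ)) - fdq N⁻¹ (-(Q μ))‖ := by
          refine (norm_add_le _ _).trans ?_; rw [norm_mul, norm_mul]
      _ ≤ ‖Q‖ * (6 * (d : ℝ) ^ (α + γ) * ‖Q‖ ^ (α + γ) * ε ^ γ)
          + (2 * (d : ℝ) ^ α * ‖Q‖ ^ α) * (2 ^ (1 - γ) * N ^ (-γ) * ‖Q‖ ^ (1 + γ)) :=
          add_le_add (mul_le_mul h1 h2 (norm_nonneg _) (norm_nonneg _))
            (mul_le_mul h3 h4 (norm_nonneg _) (by positivity))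
      _ = 6 * (d : ℝ) ^ (α + γ) * ε ^ γ * (‖Q‖ * ‖Q‖ ^ (α + γ))
          + 2 * (d : ℝ) ^ α * 2 ^ (1 - γ) * N ^ (-γ) * (‖Q‖ ^ α * ‖Q‖ ^ (1 + γ)) := by ring
      _ = _ := by rw [hp1, hp2]; ring

/-! ## §2 Torus bookkeeping: representatives, the centred difference, two lattices -/

namespace Torus

variable {d : ℕ}

/-- `|v(a − b)| = dist(a − b, Kℤ)` for the centred representative `v` of `ZMod K` and integers `a, b`
(= `B5Ineq110P12Lattice.natAbs_valMinAbs_intCast_sub`, re-proved to keep the import light). [folklore] -/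
private theorem natAbs_valMinAbs_intCast_sub' {K : ℕ} [NeZero K] (a b : ℤ) :
    ((((a : ZMod K) - (b : ZMod K)).valMinAbs.natAbs : ℕ) : ℤ) = circAbs K (a - b) := by
  have hz : ((a : ZMod K) - (b : ZMod K)) = ((a - b : ℤ) : ZMod K) := by push_cast; rfl
  rw [hz, ZMod.valMinAbs_natAbs_eq_min]
  have hv : ((((a - b : ℤ) : ZMod K)).val : ℤ) = (a - b) % (K : ℤ) := ZMod.val_intCast (a - b)
  have hle : (((a - b : ℤ) : ZMod K)).val ≤ K := (ZMod.val_lt _).le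
  rw [Nat.cast_min, Nat.cast_sub hle, hv]
  rfl

/-- A torus character through ANY integer representatives of the position: `e^{ip·z} = exp(i Σ_μ p′_μ r_μ)` whenever
`r_μ ≡ z_μ`, `p′ = sOf p` (the phase is `K_μ`-periodic in each `r_μ`). [cite: King1986, (4.1) p.670] -/
theorem chi_eq_cexp_of_rep (K : Fin d → ℕ) [∀ μ, NeZero (K μ)] (p z : Tor K) (r : Fin d → ℤ)
    (hr : ∀ μ, ((r μ : ℤ) : ZMod (K μ)) = z μ) :
    chi K p z = Complex.exp (Complex.I * ((∑ μ, sOf K p μ * (r μ : ℝ) : ℝ) : ℂ)) := by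
  unfold chi
  have hfac : ∀ μ, (ZMod.stdAddChar (N := K μ) (p μ * z μ) : ℂ)
      = Complex.exp (Complex.I * ((sOf K p μ * (r μ : ℝ) : ℝ) : ℂ)) := by
    intro μ
    have h1 : p μ * z μ = ((((p μ).valMinAbs * r μ : ℤ)) : ZMod (K μ)) := by
      push_cast
      rw [hr μ]
    rw [h1, ZMod.stdAddChar_coe]
    congr 1
    simp only [sOf]
    push_cast
    ring
  simp_rw [hfac]
  rw [← Complex.exp_sum]
  congr 1
  push_cast
  rw [Finset.mul_sum]

section OneLattice

variable (N : ℕ) [NeZero N] (M : Fin d → ℕ) [hM : ∀ μ, NeZero (M μ)]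

/-- The CENTRED integer representative of `y − x` on the fine torus, coordinatewise. [folklore] -/
def cdiff (x y : Tor (fine N M)) : Fin d → ℤ := fun μ => ((y - x) μ).valMinAbs

/-- King's `y − x` in unit-lattice coordinates: the centred representative divided by `N = η⁻¹`.
[cite: King1986, (3.62) p.663] -/
def urep (x y : Tor (fine N M)) : Fin d → ℝ := fun μ => (cdiff N M x y μ : ℝ) / N

/-- King's `|x − y|` on the torus in unit-lattice coordinates: the sup torus distance of the fine points over `N`.
[cite: King1986, (3.62) p.663] -/
def holdist (x y : Tor (fine N M)) : ℝ := tdistT (fine N M) x y / N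

/-- A fine point in unit-lattice coordinates (`ξ = x∕N`, position of the modes (4.2)). [cite: King1986, (4.2) p.670] -/
def upos (x : Tor (fine N M)) : Fin d → ℝ := fun ν => ((x ν).val : ℝ) / N

omit [NeZero N] hM in
/-- The centred representative IS a representative. [folklore] -/
private theorem cdiff_cast (x y : Tor (fine N M)) (μ : Fin d) :
    ((cdiff N M x y μ : ℤ) : ZMod (fine N M μ)) = (y - x) μ := by
  simp only [cdiff, ZMod.coe_valMinAbs]

/-- The size of the centred representative is the circular distance of the labels:
`|v((y − x)_μ)| = dist(x_μ − y_μ, K_μℤ)`. [folklore] -/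
private theorem abs_cdiff_eq (x y : Tor (fine N M)) (μ : Fin d) :
    (|cdiff N M x y μ| : ℝ) = (circAbs (fine N M μ) (((x μ).val : ℤ) - ((y μ).val : ℤ)) : ℝ) := by
  have hK : 1 ≤ fine N M μ := Nat.one_le_iff_ne_zero.mpr (NeZero.ne _)
  have h := natAbs_valMinAbs_intCast_sub' (K := fine N M μ) ((y μ).val : ℤ) ((x μ).val : ℤ)
  rw [show (((y μ).val : ℤ) : ZMod (fine N M μ)) = y μ by rw [Int.cast_natCast, ZMod.natCast_zmod_val],
    show (((x μ).val : ℤ) : ZMod (fine N M μ)) = x μ by rw [Int.cast_natCast, ZMod.natCast_zmod_val],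
    show ((y μ).val : ℤ) - ((x μ).val : ℤ) = -(((x μ).val : ℤ) - ((y μ).val : ℤ)) by ring,
    circAbs_neg hK] at h
  have h' : (|cdiff N M x y μ| : ℤ) = circAbs (fine N M μ) (((x μ).val : ℤ) - ((y μ).val : ℤ)) := by
    rw [← h, cdiff, Pi.sub_apply, Int.natCast_natAbs]
  exact_mod_cast h'

/-- **`‖y − x‖_∞ ≤ |x − y|`**: the centred representative in unit coordinates is bounded by the Hölder distance
(coordinate circular distances are `≤` the sup torus distance). [cite: King1986, (3.62) p.663] -/
theorem norm_urep_le (x y : Tor (fine N M)) : ‖urep N M x y‖ ≤ holdist N M x y := by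
  have hN : (0 : ℝ) < N := by exact_mod_cast Nat.pos_of_ne_zero (NeZero.ne N)
  have h0 : 0 ≤ holdist N M x y := div_nonneg (tdistT_nonneg _ x y) hN.le
  refine (pi_norm_le_iff_of_nonneg h0).mpr fun μ => ?_
  rw [Real.norm_eq_abs, urep, abs_div, abs_of_pos hN, holdist, div_le_div_iff_of_pos_right hN, abs_cdiff_eq]
  exact circAbs_le_tdistT (fine N M) x y μ

/-- `0 ≤ |x − y|` (King's Hölder distance on the torus). [cite: King1986, (3.62) p.663] -/
theorem holdist_nonneg (x y : Tor (fine N M)) : 0 ≤ holdist N M x y :=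
  div_nonneg (tdistT_nonneg _ x y) (Nat.cast_nonneg N)

/-- **The alias phases are `M`-periodic in the position**: for `Q = p′ + 2πw` with `p′ = sOf q` (so `Q_μM_μ ∈ 2πℤ`) and
integer shifts `t_μ`, `exp(iΣ_μ Q_μ(u_μ + M_μt_μ)) = exp(iΣ_μ Q_μu_μ)` — the torus periodicity of (4.1) in unit coordinates.
[cite: King1986, (4.1)–(4.2) p.670] -/
theorem cexp_aliasPt_dot_add_period (q : Tor M) (w : Fin d → ℤ) (u : Fin d → ℝ) (t : Fin d → ℤ) :
    Complex.exp (Complex.I * ((∑ μ, aliasPt (sOf M q) w μ * (u μ + (M μ : ℝ) * (t μ : ℝ)) : ℝ) : ℂ))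
      = Complex.exp (Complex.I * ((∑ μ, aliasPt (sOf M q) w μ * u μ : ℝ) : ℂ)) := by
  have hper : ∀ μ, aliasPt (sOf M q) w μ * ((M μ : ℝ) * (t μ : ℝ))
      = 2 * π * ((((q μ).valMinAbs + w μ * (M μ : ℤ)) * t μ : ℤ) : ℝ) := by
    intro μ
    have hMμ : (M μ : ℝ) ≠ 0 := by exact_mod_cast NeZero.ne (M μ)
    have e1 : 2 * π * ((q μ).valMinAbs : ℝ) / (M μ : ℝ) * ((M μ : ℝ) * (t μ : ℝ))
        = 2 * π * ((q μ).valMinAbs : ℝ) * (t μ : ℝ) := by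
      rw [div_mul_eq_mul_div, show 2 * π * ((q μ).valMinAbs : ℝ) * ((M μ : ℝ) * (t μ : ℝ))
        = 2 * π * ((q μ).valMinAbs : ℝ) * (t μ : ℝ) * (M μ : ℝ) by ring, mul_div_cancel_right₀ _ hMμ]
    simp only [aliasPt, sOf]
    push_cast
    rw [add_mul, e1]
    ring
  have hsum : ∑ μ, aliasPt (sOf M q) w μ * (u μ + (M μ : ℝ) * (t μ : ℝ))
      = (∑ μ, aliasPt (sOf M q) w μ * u μ)
        + 2 * π * ((∑ μ, ((q μ).valMinAbs + w μ * (M μ : ℤ)) * t μ : ℤ) : ℝ) := by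
    simp_rw [mul_add, Finset.sum_add_distrib, hper]
    push_cast
    rw [Finset.mul_sum]
  rw [hsum]
  push_cast
  rw [mul_add, Complex.exp_add]
  have hone : Complex.exp (Complex.I * (2 * (π : ℂ)
      * ∑ μ, (((q μ).valMinAbs : ℂ) + (w μ : ℂ) * (M μ : ℂ)) * (t μ : ℂ))) = 1 := by
    have := Complex.exp_int_mul_two_pi_mul_I (∑ μ, ((q μ).valMinAbs + w μ * (M μ : ℤ)) * t μ)
    push_cast at this
    rw [← this]
    congr 1
    ring
  rw [hone, mul_one]

/-- **The mode at `y` is the mode at `x` times `e^{iQ·(y − x)}`** (odd `N`, digit `w`): `modePhase Q (y∕N) = modePhase Q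
(x∕N)·exp(iΣ_μ Q_μ urep_μ)` — multiplicativity of the torus characters, read through the centred representative
(`chi_eq_cexp_of_rep`), `Nθ_μ(p) = Q_μ`. [cite: King1986, (4.1)–(4.2) p.670, (4.19) p.672] -/
theorem modePhase_pos_eq_mul (hN : Odd N) (q : Tor M) {w : Fin d → ℤ} (hw : w ∈ digitBox d N)
    (x y : Tor (fine N M)) :
    modePhase (aliasPt (sOf M q) w) (fun ν => ((y ν).val : ℝ) / N)
      = modePhase (aliasPt (sOf M q) w) (fun ν => ((x ν).val : ℝ) / N)
        * Complex.exp (Complex.I * ((∑ μ, aliasPt (sOf M q) w μ * urep N M x y μ : ℝ) : ℂ)) := by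
  have hNr : (N : ℝ) ≠ 0 := by exact_mod_cast NeZero.ne N
  set p := aliasMom N M q w with hp_def
  have hp : p ∈ fib N M q := aliasMom_mem_fib N M q w
  have hdig : digit N M q p = w := digit_aliasMom N M hN q hw
  have hy : y = x + (y - x) := by abel
  rw [← hdig, ← chi_fine_eq_modePhase N M hp, ← chi_fine_eq_modePhase N M hp]
  conv_lhs => rw [hy]
  rw [chi_add_right, chi_eq_cexp_of_rep (fine N M) p (y - x) (cdiff N M x y) (cdiff_cast N M x y)]
  have hsum : (∑ μ, sOf (fine N M) p μ * (cdiff N M x y μ : ℝ))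
      = ∑ μ, aliasPt (sOf M q) (digit N M q p) μ * urep N M x y μ := by
    refine Finset.sum_congr rfl fun μ _ => ?_
    rw [urep, ← natMul_sOf_fine_eq_aliasPt N M hp μ]
    field_simp
  rw [hsum]

end OneLattice

section TwoLattices

variable (N R : ℕ) [NeZero N] [NeZero R] (M : Fin d → ℕ) [hM : ∀ μ, NeZero (M μ)]

/-- The digit displacement between the two lattices: `e_μ = (y′_μ − x′_μ) − R(y_μ − x_μ)` for the labels, `|e_μ| ≤ R − 1`
when `x_μ = ⌊x′_μ∕R⌋`, `y_μ = ⌊y′_μ∕R⌋`. [cite: King1986, p.664 («x′ ∈ B^n(x)»)] -/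
def ediff (x y : Tor (fine N M)) (x' y' : Tor (fine (R * N) M)) : Fin d → ℤ :=
  fun μ => (((y' μ).val : ℤ) - ((x' μ).val : ℤ)) - (R : ℤ) * (((y μ).val : ℤ) - ((x μ).val : ℤ))

/-- A representative of `y′ − x′` on the finer torus in unit coordinates, CHOSEN CLOSE to `urep x y`:
`(R·v(y − x) + e)∕(RN)`. [cite: King1986, (4.27) p.673] -/
def urepOver (x y : Tor (fine N M)) (x' y' : Tor (fine (R * N) M)) : Fin d → ℝ :=
  fun μ => (((R : ℤ) * cdiff N M x y μ + ediff N R M x y x' y' μ : ℤ) : ℝ) / ((R : ℝ) * N)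

omit [NeZero N] hM in
/-- `|e_μ| ≤ R − 1`. [folklore] -/
private theorem abs_ediff_le (x y : Tor (fine N M)) (x' y' : Tor (fine (R * N) M))
    (hxx : ∀ μ, (x μ).val = (x' μ).val / R) (hyy : ∀ μ, (y μ).val = (y' μ).val / R) (μ : Fin d) :
    |ediff N R M x y x' y' μ| ≤ (R : ℤ) - 1 := by
  have hR : 0 < R := Nat.pos_of_ne_zero (NeZero.ne R)
  have hx := Nat.div_add_mod ((x' μ).val) R
  have hy := Nat.div_add_mod ((y' μ).val) R
  have hxm : (x' μ).val % R < R := Nat.mod_lt _ hR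
  have hym : (y' μ).val % R < R := Nat.mod_lt _ hR
  rw [← hxx μ] at hx
  rw [← hyy μ] at hy
  have hx' : ((x' μ).val : ℤ) = (R : ℤ) * ((x μ).val : ℤ) + (((x' μ).val % R : ℕ) : ℤ) := by exact_mod_cast hx.symm
  have hy' : ((y' μ).val : ℤ) = (R : ℤ) * ((y μ).val : ℤ) + (((y' μ).val % R : ℕ) : ℤ) := by exact_mod_cast hy.symm
  have hxm' : (((x' μ).val % R : ℕ) : ℤ) + 1 ≤ (R : ℤ) := by exact_mod_cast hxm
  have hym' : (((y' μ).val % R : ℕ) : ℤ) + 1 ≤ (R : ℤ) := by exact_mod_cast hym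
  have h0x : (0 : ℤ) ≤ (((x' μ).val % R : ℕ) : ℤ) := by positivity
  have h0y : (0 : ℤ) ≤ (((y' μ).val % R : ℕ) : ℤ) := by positivity
  have hid : ediff N R M x y x' y' μ = (((y' μ).val % R : ℕ) : ℤ) - (((x' μ).val % R : ℕ) : ℤ) := by
    unfold ediff; rw [hx', hy']; ring
  rw [hid, abs_le]
  constructor <;> linarith

omit hM in
/-- `urepOver − urep = e∕(RN)`, hence **`‖urepOver − urep‖_∞ ≤ N⁻¹`** (indeed `≤ (R − 1)∕(RN)`).
[cite: King1986, (4.27) p.673] -/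
theorem norm_urepOver_sub_le (x y : Tor (fine N M)) (x' y' : Tor (fine (R * N) M))
    (hxx : ∀ μ, (x μ).val = (x' μ).val / R) (hyy : ∀ μ, (y μ).val = (y' μ).val / R) :
    ‖urepOver N R M x y x' y' - urep N M x y‖ ≤ (N : ℝ)⁻¹ := by
  have hN : (0 : ℝ) < N := by exact_mod_cast Nat.pos_of_ne_zero (NeZero.ne N)
  have hR : (0 : ℝ) < R := by exact_mod_cast Nat.pos_of_ne_zero (NeZero.ne R)
  have hR1 : (1 : ℝ) ≤ R := by exact_mod_cast Nat.pos_of_ne_zero (NeZero.ne R)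
  refine (pi_norm_le_iff_of_nonneg (inv_nonneg.mpr hN.le)).mpr fun μ => ?_
  have he := abs_ediff_le N R M x y x' y' hxx hyy μ
  have he' : |(ediff N R M x y x' y' μ : ℝ)| ≤ (R : ℝ) - 1 := by
    have h := he; rw [← Int.cast_abs] at *; exact_mod_cast h
  have hid : (urepOver N R M x y x' y' - urep N M x y) μ = (ediff N R M x y x' y' μ : ℝ) / ((R : ℝ) * N) := by
    simp only [Pi.sub_apply, urepOver, urep]
    push_cast
    field_simp
    ring
  rw [Real.norm_eq_abs, hid, abs_div, abs_of_pos (mul_pos hR hN)]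
  rw [div_le_iff₀ (mul_pos hR hN)]
  calc |(ediff N R M x y x' y' μ : ℝ)| ≤ (R : ℝ) - 1 := he'
    _ ≤ (N : ℝ)⁻¹ * ((R : ℝ) * N) := by rw [mul_comm (R : ℝ) (N : ℝ), inv_mul_cancel_left₀ hN.ne']; linarith

/-- `urepOver` IS a representative of `y′ − x′`: `R·v(y − x) + e ≡ (y′ − x′)_μ` modulo `RNM_μ`. [folklore] -/
private theorem urepOver_cast (x y : Tor (fine N M)) (x' y' : Tor (fine (R * N) M)) (μ : Fin d) :
    ((((R : ℤ) * cdiff N M x y μ + ediff N R M x y x' y' μ : ℤ)) : ZMod (fine (R * N) M μ)) = (y' - x') μ := by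
  -- `v(y − x) ≡ y − x` modulo `NM_μ`, so `R·(v − (y − x)) ≡ 0` modulo `RNM_μ`
  have hc : ((cdiff N M x y μ : ℤ) : ZMod (fine N M μ))
      = ((((y μ).val : ℤ) - ((x μ).val : ℤ) : ℤ) : ZMod (fine N M μ)) := by
    rw [cdiff_cast]; push_cast; rw [ZMod.natCast_zmod_val, ZMod.natCast_zmod_val, Pi.sub_apply]
  have hdvd : ((fine N M μ : ℕ) : ℤ) ∣ (((y μ).val : ℤ) - ((x μ).val : ℤ)) - cdiff N M x y μ :=
    (ZMod.intCast_eq_intCast_iff_dvd_sub _ _ _).mp hc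
  have hdvd' : ((fine (R * N) M μ : ℕ) : ℤ) ∣ (R : ℤ) * ((((y μ).val : ℤ) - ((x μ).val : ℤ)) - cdiff N M x y μ) := by
    have : ((fine (R * N) M μ : ℕ) : ℤ) = (R : ℤ) * ((fine N M μ : ℕ) : ℤ) := by
      simp only [fine]; push_cast; ring
    rw [this]
    exact mul_dvd_mul_left _ hdvd
  have hzero : (((R : ℤ) * ((((y μ).val : ℤ) - ((x μ).val : ℤ)) - cdiff N M x y μ) : ℤ) : ZMod (fine (R * N) M μ)) = 0 :=
    (ZMod.intCast_zmod_eq_zero_iff_dvd _ _).mpr hdvd'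
  have hid : ((R : ℤ) * cdiff N M x y μ + ediff N R M x y x' y' μ : ℤ)
      = (((y' μ).val : ℤ) - ((x' μ).val : ℤ)) - (R : ℤ) * ((((y μ).val : ℤ) - ((x μ).val : ℤ)) - cdiff N M x y μ) := by
    unfold ediff; ring
  rw [hid, Int.cast_sub, hzero, sub_zero]
  push_cast
  rw [ZMod.natCast_zmod_val, ZMod.natCast_zmod_val, Pi.sub_apply]

/-- `urepOver` and the centred representative of `y′ − x′` differ by a lattice vector `(M_μt_μ)_μ`. [folklore] -/
private theorem urepOver_sub_urep (x y : Tor (fine N M)) (x' y' : Tor (fine (R * N) M)) :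
    ∃ t : Fin d → ℤ, ∀ μ, urepOver N R M x y x' y' μ = urep (R * N) M x' y' μ + (M μ : ℝ) * (t μ : ℝ) := by
  have hN : (N : ℝ) ≠ 0 := by exact_mod_cast NeZero.ne N
  have hR : (R : ℝ) ≠ 0 := by exact_mod_cast NeZero.ne R
  have hdiv : ∀ μ, ((fine (R * N) M μ : ℕ) : ℤ) ∣
      ((R : ℤ) * cdiff N M x y μ + ediff N R M x y x' y' μ) - cdiff (R * N) M x' y' μ := by
    intro μ
    apply (ZMod.intCast_eq_intCast_iff_dvd_sub _ _ _).mp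
    rw [urepOver_cast, cdiff_cast]
  choose t ht using hdiv
  have hRN : (R : ℝ) * N ≠ 0 := mul_ne_zero hR hN
  refine ⟨t, fun μ => ?_⟩
  have h := ht μ
  have h' : (((R : ℤ) * cdiff N M x y μ + ediff N R M x y x' y' μ : ℤ) : ℝ)
      = (cdiff (R * N) M x' y' μ : ℝ) + ((R : ℝ) * N * (M μ : ℝ)) * (t μ : ℝ) := by
    have h2 : ((R : ℤ) * cdiff N M x y μ + ediff N R M x y x' y' μ : ℤ)
        = cdiff (R * N) M x' y' μ + ((fine (R * N) M μ : ℕ) : ℤ) * t μ := by linarith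
    have h3 : (((fine (R * N) M μ : ℕ) : ℤ) : ℝ) = (R : ℝ) * N * (M μ : ℝ) := by simp only [fine]; push_cast; ring
    rw [h2, Int.cast_add, Int.cast_mul, h3]
  show (((R : ℤ) * cdiff N M x y μ + ediff N R M x y x' y' μ : ℤ) : ℝ) / ((R : ℝ) * N)
    = (cdiff (R * N) M x' y' μ : ℝ) / (((R * N : ℕ)) : ℝ) + (M μ : ℝ) * (t μ : ℝ)
  rw [h', Nat.cast_mul, add_div, show (R : ℝ) * N * (M μ : ℝ) * (t μ : ℝ) = ((R : ℝ) * N) * ((M μ : ℝ) * (t μ : ℝ)) by ring,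
    mul_div_cancel_left₀ _ hRN]

/-- Hence the alias phases of `urepOver` and of the centred representative of `y′ − x′` AGREE.
[cite: King1986, (4.1)–(4.2) p.670] -/
theorem cexp_dot_urepOver (q : Tor M) (w : Fin d → ℤ) (x y : Tor (fine N M)) (x' y' : Tor (fine (R * N) M)) :
    Complex.exp (Complex.I * ((∑ μ, aliasPt (sOf M q) w μ * urepOver N R M x y x' y' μ : ℝ) : ℂ))
      = Complex.exp (Complex.I * ((∑ μ, aliasPt (sOf M q) w μ * urep (R * N) M x' y' μ : ℝ) : ℂ)) := by
  obtain ⟨t, ht⟩ := urepOver_sub_urep N R M x y x' y'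
  simp_rw [ht]
  exact cexp_aliasPt_dot_add_period M q w _ t

omit hM in
/-- `circAbs` is 1-Lipschitz: `|dist(a − e, Kℤ) − dist(a, Kℤ)| ≤ |e|`. [folklore] -/
private theorem abs_circAbs_sub_sub_le {K : ℕ} (hK : 1 ≤ K) (a e : ℤ) :
    |circAbs K (a - e) - circAbs K a| ≤ |e| := by
  rw [abs_le]
  constructor
  · have h := circAbs_add_le hK (a - e) e
    rw [sub_add_cancel] at h
    have h2 := circAbs_le_abs hK e
    linarith
  · have h := circAbs_add_le hK a (-e)
    rw [← sub_eq_add_neg] at h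
    have h2 := circAbs_le_abs hK (-e)
    rw [abs_neg] at h2
    linarith

/-- Coordinate circular distances of the two lattices: `|dist′(x′_μ − y′_μ) − R·dist(x_μ − y_μ)| ≤ R − 1`
(`circAbs_mul_mul` for the scaling, Lipschitz for the digits). [cite: King1986, (4.27) p.673] -/
theorem abs_circAbs_two_lattices (x y : Tor (fine N M)) (x' y' : Tor (fine (R * N) M))
    (hxx : ∀ μ, (x μ).val = (x' μ).val / R) (hyy : ∀ μ, (y μ).val = (y' μ).val / R) (μ : Fin d) :
    |(circAbs (fine (R * N) M μ) (((x' μ).val : ℤ) - ((y' μ).val : ℤ)) : ℝ)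
        - (R : ℝ) * (circAbs (fine N M μ) (((x μ).val : ℤ) - ((y μ).val : ℤ)) : ℝ)| ≤ (R : ℝ) - 1 := by
  have hR : 0 < R := Nat.pos_of_ne_zero (NeZero.ne R)
  have hK' : 1 ≤ fine (R * N) M μ := Nat.one_le_iff_ne_zero.mpr (NeZero.ne _)
  have hscale : circAbs (fine (R * N) M μ) ((R : ℤ) * (((x μ).val : ℤ) - ((y μ).val : ℤ)))
      = (R : ℤ) * circAbs (fine N M μ) (((x μ).val : ℤ) - ((y μ).val : ℤ)) := by
    have h := circAbs_mul_mul hR (fine N M μ) (((x μ).val : ℤ) - ((y μ).val : ℤ))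
    rwa [show R * fine N M μ = fine (R * N) M μ by simp only [fine]; ring] at h
  have hrel : ((x' μ).val : ℤ) - ((y' μ).val : ℤ)
      = (R : ℤ) * (((x μ).val : ℤ) - ((y μ).val : ℤ)) - ediff N R M x y x' y' μ := by
    unfold ediff; ring
  have h := abs_circAbs_sub_sub_le hK' ((R : ℤ) * (((x μ).val : ℤ) - ((y μ).val : ℤ))) (ediff N R M x y x' y' μ)
  rw [← hrel, hscale] at h
  have he := abs_ediff_le N R M x y x' y' hxx hyy μ
  have h' : |circAbs (fine (R * N) M μ) (((x' μ).val : ℤ) - ((y' μ).val : ℤ))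
      - (R : ℤ) * circAbs (fine N M μ) (((x μ).val : ℤ) - ((y μ).val : ℤ))| ≤ (R : ℤ) - 1 := h.trans he
  exact_mod_cast h'

/-- **(4.27) on the torus**: `||x′ − y′| − |x − y|| ≤ N⁻¹` for the points `x, y` under `x′, y′` — the two Hölder distances
(sup torus distances in unit coordinates) differ by at most `(R − 1)∕(RN)`. [cite: King1986, (4.27) p.673] -/
theorem abs_holdist_sub_le (x y : Tor (fine N M)) (x' y' : Tor (fine (R * N) M))
    (hxx : ∀ μ, (x μ).val = (x' μ).val / R) (hyy : ∀ μ, (y μ).val = (y' μ).val / R) :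
    |holdist (R * N) M x' y' - holdist N M x y| ≤ (N : ℝ)⁻¹ := by
  have hN : (0 : ℝ) < N := by exact_mod_cast Nat.pos_of_ne_zero (NeZero.ne N)
  have hR : (0 : ℝ) < R := by exact_mod_cast Nat.pos_of_ne_zero (NeZero.ne R)
  -- the two sup distances compared in lattice units: `|T′ − R·T| ≤ R − 1`
  have hcmp : |tdistT (fine (R * N) M) x' y' - (R : ℝ) * tdistT (fine N M) x y| ≤ (R : ℝ) - 1 := by
    rcases Nat.eq_zero_or_pos d with hd | hd
    · subst hd
      rw [tdistT_eq_zero_of_d _ rfl, tdistT_eq_zero_of_d _ rfl, mul_zero, sub_zero, abs_zero]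
      linarith [show (1 : ℝ) ≤ R by exact_mod_cast Nat.pos_of_ne_zero (NeZero.ne R)]
    · rw [abs_le]
      constructor
      · -- R·T ≤ T′ + (R − 1): take a coordinate realising T
        obtain ⟨μ, hμ⟩ := exists_coord_eq_tdistT (fine N M) hd.ne' x y
        have h1 := abs_circAbs_two_lattices N R M x y x' y' hxx hyy μ
        have h2 := circAbs_le_tdistT (fine (R * N) M) x' y' μ
        rw [abs_le] at h1
        rw [hμ]
        linarith [h1.2]
      · -- T′ ≤ R·T + (R − 1): take a coordinate realising T′
        obtain ⟨μ, hμ⟩ := exists_coord_eq_tdistT (fine (R * N) M) hd.ne' x' y'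
        have h1 := abs_circAbs_two_lattices N R M x y x' y' hxx hyy μ
        have h2 := circAbs_le_tdistT (fine N M) x y μ
        rw [abs_le] at h1
        rw [hμ]
        nlinarith [h1.1, h2, hR.le]
  have hid : holdist (R * N) M x' y' - holdist N M x y
      = (tdistT (fine (R * N) M) x' y' - (R : ℝ) * tdistT (fine N M) x y) / ((R : ℝ) * N) := by
    simp only [holdist]; push_cast; field_simp
  rw [hid, abs_div, abs_of_pos (mul_pos hR hN), div_le_iff₀ (mul_pos hR hN)]
  calc _ ≤ (R : ℝ) - 1 := hcmp
    _ ≤ (N : ℝ)⁻¹ * ((R : ℝ) * N) := by rw [mul_comm (R : ℝ) (N : ℝ), inv_mul_cancel_left₀ hN.ne']; linarith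

end TwoLattices

/-! ## §3 The Hölder quotients as King's digit sums (4.19) with the factor `|x − y|^{−α}{1 − exp[iQ(y − x)]}` -/

section DigitSums

variable (N : ℕ) [NeZero N] (M : Fin d → ℕ) [hM : ∀ μ, NeZero (M μ)]

/-- **THE HÖLDER QUOTIENT OF THE MINIMISER KERNEL AS KING'S DIGIT SUM** (odd `N`, `c = N²`, `a > 0`, `m² > 0`):
`|x − y|^{−α}(ℋ_k(x, b) − ℋ_k(y, b)) = |Ω|⁻¹ Σ_q e^{−iq·b} Σ_{j ∈ digitBox} Δ^{(k)}(p′)u^η(Q)Δ^η(Q)⁻¹e^{iQ·ξ}·|x − y|^{−α}{1 −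
e^{iQ·(y−x)}}` (`Q = p′ + 2πj`, `ξ = x∕N`) — the third line of (4.19) (the sign of `y − x` in the exponent follows the torus
characters; King prints `exp[i(p′+l)(y − x)]` with `e^{i(p′+l)(x−z)}` in front, the same expression).
[cite: King1986, (3.62) p.663, (4.19) p.672] -/
theorem holder_kernel_eq_digitSum (hN : Odd N) (hN1 : 1 ≤ N) {a m2 : ℝ} (ha : 0 < a) (hm : 0 < m2) (α : ℝ)
    (b : Tor M) (x y : Tor (fine N M)) :
    (((holdist N M x y) ^ (-α) * (minimiser N M a ((N : ℝ) ^ 2) m2 (Pi.single b 1) x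
        - minimiser N M a ((N : ℝ) ^ 2) m2 (Pi.single b 1) y) : ℝ) : ℂ)
      = (Fintype.card (Tor M) : ℂ)⁻¹
        * ∑ q : Tor M, conj (chi M q b)
            * ∑ w ∈ digitBox d N, fmodeTerm (DeltaEff a N m2 (sOf M q)) (N : ℝ)⁻¹ m2 (aliasPt (sOf M q) w)
                (upos N M x) (holderFac α (holdist N M x y) (urep N M x y)) := by
  unfold upos
  push_cast
  rw [minimiser_kernel_eq_digitSum N M hN hN1 ha hm b x, minimiser_kernel_eq_digitSum N M hN hN1 ha hm b y,
    ← mul_sub, ← Finset.sum_sub_distrib, mul_left_comm, Finset.mul_sum]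
  congr 1
  refine Finset.sum_congr rfl fun q _ => ?_
  rw [← mul_sub, ← Finset.sum_sub_distrib, mul_left_comm, Finset.mul_sum]
  congr 1
  refine Finset.sum_congr rfl fun w hw => ?_
  have hphase := modePhase_pos_eq_mul N M hN q hw x y
  simp only [fmodeTerm, holderFac, modeTerm]
  rw [hphase]
  push_cast
  ring

/-- **THE HÖLDER QUOTIENT OF THE LATTICE DERIVATIVE OF THE MINIMISER KERNEL AS KING'S DIGIT SUM** — the fourth line of
(4.19): `|x − y|^{−α}(∂^η_μℋ_k(x, b) − ∂^η_μℋ_k(y, b))` carries both extra factors `η⁻¹(e^{iηQ_μ} − 1)` and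
`|x − y|^{−α}{1 − e^{iQ·(y−x)}}`. [cite: King1986, (4.19) p.672] -/
theorem holder_dkernel_eq_digitSum (hN : Odd N) (hN1 : 1 ≤ N) {a m2 : ℝ} (ha : 0 < a) (hm : 0 < m2) (α : ℝ)
    (b : Tor M) (x y : Tor (fine N M)) (μ : Fin d) :
    (((holdist N M x y) ^ (-α)
        * ((N : ℝ) * (minimiser N M a ((N : ℝ) ^ 2) m2 (Pi.single b 1) (x + unitVec (fine N M) μ)
            - minimiser N M a ((N : ℝ) ^ 2) m2 (Pi.single b 1) x)
          - (N : ℝ) * (minimiser N M a ((N : ℝ) ^ 2) m2 (Pi.single b 1) (y + unitVec (fine N M) μ)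
            - minimiser N M a ((N : ℝ) ^ 2) m2 (Pi.single b 1) y)) : ℝ) : ℂ)
      = (Fintype.card (Tor M) : ℂ)⁻¹
        * ∑ q : Tor M, conj (chi M q b)
            * ∑ w ∈ digitBox d N, fmodeTerm (DeltaEff a N m2 (sOf M q)) (N : ℝ)⁻¹ m2 (aliasPt (sOf M q) w)
                (upos N M x) (fun Q => fdq (N : ℝ)⁻¹ (-(Q μ)) * holderFac α (holdist N M x y) (urep N M x y) Q) := by
  have hx := dminimiser_kernel_eq_digitSum N M hN hN1 ha hm b x μ
  have hy := dminimiser_kernel_eq_digitSum N M hN hN1 ha hm b y μ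
  unfold upos
  push_cast at hx hy ⊢
  rw [hx, hy, ← mul_sub, ← Finset.sum_sub_distrib, mul_left_comm, Finset.mul_sum]
  congr 1
  refine Finset.sum_congr rfl fun q _ => ?_
  rw [← mul_sub, ← Finset.sum_sub_distrib, mul_left_comm, Finset.mul_sum]
  congr 1
  refine Finset.sum_congr rfl fun w hw => ?_
  have hphase := modePhase_pos_eq_mul N M hN q hw x y
  simp only [fmodeTerm, dmodeTerm, holderFac, modeTerm]
  rw [hphase]
  push_cast
  ring

end DigitSums

/-! ## §4 The torus assembly for a general factor, and the two Hölder lines of (3.71) -/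

/-- Positions in unit coordinates of a point over another are `N⁻¹`-close (restated for `upos`).
[cite: King1986, p.664 (before Prop. 3.8)] -/
theorem abs_upos_sub_le {L k n : ℕ} [NeZero L] (hk1 : 1 ≤ L ^ k) (hn1 : 1 ≤ L ^ n) (M : Fin d → ℕ)
    [∀ μ, NeZero (M μ)] (x : Tor (fine (L ^ k) M)) (x' : Tor (fine (L ^ n * L ^ k) M))
    (hx : ∀ μ, (x μ).val = (x' μ).val / L ^ n) (ν : Fin d) :
    |upos (L ^ n * L ^ k) M x' ν - upos (L ^ k) M x ν| ≤ (((L ^ k : ℕ) : ℝ))⁻¹ := by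
  have h := abs_pos_sub_le hk1 hn1 (hx ν)
  simpa [upos, Nat.cast_mul] using h

/-- **THE TORUS ASSEMBLY FOR A GENERAL EXTRA FACTOR.**  Two real quantities `F_A`, `F_B` given as King's digit sums over
the two lattices (odd `L ≥ 2`, `k, n ≥ 1`, King's symbols, positions `N⁻¹`-close) with factor families `E_A`, `E_B` obeying
`‖E_B(Q)‖ ≤ c_E‖Q‖^β` and `‖E_B(Q) − E_A(Q)‖ ≤ (r_E(L^k)^{−γ} + s_E(L^k)^{−γ})‖Q‖^{β+γ}` at every alias momentum
`Q = p′ + 2πw` of every reduced momentum `p′ = sOf q` (`0 ≤ γ ≤ 1`, `0 ≤ β`, `β + γ < 2`): `|F_B − F_A| ≤ (C₁^E + C₂^E)·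
(L^k)^{−γ}` — the average over the reduced momenta of `king_prop38_factor_aliasSums` at `δ = L^{−k}`.
[cite: King1986, Prop. 3.8 (3.71) p.664; (4.19)–(4.31) pp.672–674] -/
theorem factor_two_spacing_torus (hd : 0 < d) {L : ℕ} [NeZero L] (hLodd : Odd L) (hL : 2 ≤ L) {k n : ℕ}
    (hk : 1 ≤ k) (hn : 1 ≤ n) (M : Fin d → ℕ) [hM : ∀ μ, NeZero (M μ)] {a m2 : ℝ} (ha : 0 < a) (hm : 0 < m2)
    {γ : ℝ} (hγ0 : 0 ≤ γ) (hγ1 : γ ≤ 1) {β : ℝ} (hβ : 0 ≤ β) (hβγ : β + γ < 2) (b : Tor M)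
    {ξ ξ' : Fin d → ℝ} (hξ : ∀ ν, |ξ' ν - ξ ν| ≤ (((L ^ k : ℕ) : ℝ))⁻¹)
    (EA EB : (Fin d → ℝ) → ℂ) {cE rE sE : ℝ} (hcE : 0 ≤ cE) (hrE : 0 ≤ rE) (hsE : 0 ≤ sE)
    (hEB : ∀ (q : Tor M) (w : Fin d → ℤ), ‖EB (aliasPt (sOf M q) w)‖ ≤ cE * ‖aliasPt (sOf M q) w‖ ^ β)
    (hEd : ∀ (q : Tor M) (w : Fin d → ℤ), ‖EB (aliasPt (sOf M q) w) - EA (aliasPt (sOf M q) w)‖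
      ≤ (rE * ((L ^ k : ℕ) : ℝ) ^ (-γ) + sE * ((((L ^ k : ℕ) : ℝ))⁻¹) ^ γ) * ‖aliasPt (sOf M q) w‖ ^ (β + γ))
    {FA FB : ℝ}
    (hA : ((FA : ℝ) : ℂ) = (Fintype.card (Tor M) : ℂ)⁻¹ * ∑ q : Tor M, conj (chi M q b)
      * ∑ w ∈ digitBox d (L ^ k), fmodeTerm (DeltaEff (aK a L k) (L ^ k) m2 (sOf M q)) (((L ^ k : ℕ) : ℝ))⁻¹ m2
          (aliasPt (sOf M q) w) ξ EA)
    (hB : ((FB : ℝ) : ℂ) = (Fintype.card (Tor M) : ℂ)⁻¹ * ∑ q : Tor M, conj (chi M q b)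
      * ∑ w ∈ digitBox d (L ^ n * L ^ k), fmodeTerm (DeltaEff (aK a L (k + n)) (L ^ n * L ^ k) m2 (sOf M q))
          (((L ^ n * L ^ k : ℕ) : ℝ))⁻¹ m2 (aliasPt (sOf M q) w) ξ' EB) :
    |FB - FA| ≤ (fprop38RateConst a a (lemma43Const a L k n) ((π ^ 2 / 4) ^ d) d γ β cE rE
        + fprop38PosConst a ((π ^ 2 / 4) ^ d) d γ β cE sE) * ((L ^ k : ℕ) : ℝ) ^ (-γ) := by
  have hNodd : Odd (L ^ k) := hLodd.pow
  have hRodd : Odd (L ^ n) := hLodd.pow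
  have hNr : (0 : ℝ) < ((L ^ k : ℕ) : ℝ) := by exact_mod_cast Nat.pos_of_ne_zero (pow_ne_zero _ (NeZero.ne L))
  have hcard : (Fintype.card (Tor M) : ℝ) ≠ 0 := by exact_mod_cast Fintype.card_ne_zero
  have hδγ : ((((L ^ k : ℕ) : ℝ))⁻¹) ^ γ = ((L ^ k : ℕ) : ℝ) ^ (-γ) := by
    rw [Real.inv_rpow hNr.le, ← Real.rpow_neg hNr.le]
  set Bd : ℝ := (fprop38RateConst a a (lemma43Const a L k n) ((π ^ 2 / 4) ^ d) d γ β cE rE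
      + fprop38PosConst a ((π ^ 2 / 4) ^ d) d γ β cE sE) * ((L ^ k : ℕ) : ℝ) ^ (-γ) with hBd
  -- one reduced momentum
  have hq : ∀ q : Tor M,
      ‖(∑ w ∈ digitBox d (L ^ n * L ^ k), fmodeTerm (DeltaEff (aK a L (k + n)) (L ^ n * L ^ k) m2 (sOf M q))
          (((L ^ n * L ^ k : ℕ) : ℝ))⁻¹ m2 (aliasPt (sOf M q) w) ξ' EB)
        - ∑ j ∈ digitBox d (L ^ k), fmodeTerm (DeltaEff (aK a L k) (L ^ k) m2 (sOf M q)) (((L ^ k : ℕ) : ℝ))⁻¹ m2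
          (aliasPt (sOf M q) j) ξ EA‖ ≤ Bd := by
    intro q
    rw [show digitBox d (L ^ n * L ^ k) = digitBox d (L ^ k * L ^ n) by rw [Nat.mul_comm],
      sum_digitBox_mul hNodd hRodd]
    refine (norm_digitSum_sub_le (N := L ^ k) (R := L ^ n)
      (fun w => fmodeTerm (DeltaEff (aK a L (k + n)) (L ^ n * L ^ k) m2 (sOf M q)) (((L ^ n * L ^ k : ℕ) : ℝ))⁻¹ m2
        (aliasPt (sOf M q) w) ξ' EB)
      (fun j => fmodeTerm (DeltaEff (aK a L k) (L ^ k) m2 (sOf M q)) (((L ^ k : ℕ) : ℝ))⁻¹ m2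
        (aliasPt (sOf M q) j) ξ EA)).trans ?_
    have hEd' : ∀ w : Fin d → ℤ, ‖EB (aliasPt (sOf M q) w) - EA (aliasPt (sOf M q) w)‖
        ≤ (rE * ((L ^ k : ℕ) : ℝ) ^ (-γ) + sE * ((((L ^ k : ℕ) : ℝ))⁻¹) ^ γ) * ‖aliasPt (sOf M q) w‖ ^ (β + γ) :=
      fun w => hEd q w
    have hK := king_prop38_factor_aliasSums hd ha hL hk hn hm hγ0 hγ1 hβ hβγ (abs_sOf_le M q)
      (J := digitBox d (L ^ k)) (B := digitBox d (L ^ n))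
      (fun j hj ν => two_abs_lt_of_mem_digitBox (L ^ k) hNodd hj ν)
      (fun c hc ν => two_abs_lt_of_mem_digitBox (L ^ n) hRodd hc ν)
      (inv_nonneg.mpr hNr.le) hξ hcE hrE hsE (fun w => hEB q w) hEd'
    rw [← Nat.cast_mul] at hK
    refine hK.trans (le_of_eq ?_)
    rw [hBd, hδγ]
    ring
  -- the difference as `|Ω|⁻¹ Σ_q e^{−iq·b}(S_B(q) − S_A(q))`
  have hdiff : (((FB - FA : ℝ)) : ℂ) = (Fintype.card (Tor M) : ℂ)⁻¹ * ∑ q : Tor M, conj (chi M q b)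
      * ((∑ w ∈ digitBox d (L ^ n * L ^ k), fmodeTerm (DeltaEff (aK a L (k + n)) (L ^ n * L ^ k) m2 (sOf M q))
            (((L ^ n * L ^ k : ℕ) : ℝ))⁻¹ m2 (aliasPt (sOf M q) w) ξ' EB)
          - ∑ j ∈ digitBox d (L ^ k), fmodeTerm (DeltaEff (aK a L k) (L ^ k) m2 (sOf M q)) (((L ^ k : ℕ) : ℝ))⁻¹ m2
            (aliasPt (sOf M q) j) ξ EA) := by
    rw [Complex.ofReal_sub, hB, hA, ← mul_sub, ← Finset.sum_sub_distrib]
    congr 1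
    refine Finset.sum_congr rfl fun q _ => ?_
    ring
  have hnorm : ∀ r : ℝ, |r| = ‖((r : ℝ) : ℂ)‖ := fun r => by rw [Complex.norm_real, Real.norm_eq_abs]
  have hchi : ∀ q : Tor M, ‖conj (chi M q b)‖ = 1 := fun q => by
    rw [conj_chi]; unfold chi; rw [norm_prod]
    exact Finset.prod_eq_one fun μ _ => by rw [ZMod.stdAddChar_apply, Circle.norm_coe]
  rw [hnorm, hdiff, norm_mul, norm_inv, Complex.norm_natCast]
  have hsum : ‖∑ q : Tor M, conj (chi M q b)
      * ((∑ w ∈ digitBox d (L ^ n * L ^ k), fmodeTerm (DeltaEff (aK a L (k + n)) (L ^ n * L ^ k) m2 (sOf M q))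
            (((L ^ n * L ^ k : ℕ) : ℝ))⁻¹ m2 (aliasPt (sOf M q) w) ξ' EB)
          - ∑ j ∈ digitBox d (L ^ k), fmodeTerm (DeltaEff (aK a L k) (L ^ k) m2 (sOf M q)) (((L ^ k : ℕ) : ℝ))⁻¹ m2
            (aliasPt (sOf M q) j) ξ EA)‖ ≤ ∑ _q : Tor M, Bd := by
    refine (norm_sum_le _ _).trans (Finset.sum_le_sum fun q _ => ?_)
    rw [norm_mul, hchi q, one_mul]
    exact hq q
  calc (Fintype.card (Tor M) : ℝ)⁻¹ * _ ≤ (Fintype.card (Tor M) : ℝ)⁻¹ * ∑ _q : Tor M, Bd :=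
        mul_le_mul_of_nonneg_left hsum (by positivity)
    _ = Bd := by
        rw [Finset.sum_const, Finset.card_univ, nsmul_eq_mul, ← mul_assoc, inv_mul_cancel₀ hcard, one_mul]

/-- **KING'S PROPOSITION 3.8, THIRD LINE OF (3.71), ON THE TORUS, SUP-NORM FORM, FOR THE ACTUAL OPERATORS.**  Odd
`L ≥ 2`, `k, n ≥ 1`, `a > 0`, `m² > 0`, any unit torus `Ω = Π_μ ℤ∕M_μ`, King's kernels `ℋ_k` on `Tor (fine L^k M)` and
`ℋ_{k+n}` on `Tor (fine (L^nL^k) M)`, the Hölder quotients `(∂_α(x, y)ℋ)(b) = |x − y|^{−α}(ℋ(x, b) − ℋ(y, b))` with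
`|x − y|` the sup torus distance in unit coordinates (`holdist`).  If `x′, y′ ∈ T_{η′}` lie over `x, y ∈ T_η` then for every
`b`, `0 ≤ α`, `0 < γ` with `α + γ ≤ 1`:  `|(∂_α(x′,y′)ℋ_{k+n})(b) − (∂_α(x,y)ℋ_k)(b)| ≤ (C₁ + C₂)·L^{−γk}`,
`C₁ = fprop38RateConst a a θ (π²∕4)^d d γ α (2d^α) 0`, `C₂ = fprop38PosConst a (π²∕4)^d d γ α (2d^α) (6d^{α+γ})`,
`θ = lemma43Const a L k n` — uniformly in the points, `M`, `m²`, `n`.  (Print assumes `γ ≦ α` and `α + γ < 1`; the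
momentum bookkeeping needs neither here since this line carries no derivative factor.) [cite: King1986, Prop. 3.8 (3.71) p.664; (4.19), (4.26)–(4.28) pp.672–673] -/
theorem king_prop38_holder_torus (hd : 0 < d) {L : ℕ} [NeZero L] (hLodd : Odd L) (hL : 2 ≤ L) {k n : ℕ}
    (hk : 1 ≤ k) (hn : 1 ≤ n) (M : Fin d → ℕ) [hM : ∀ μ, NeZero (M μ)] {a m2 : ℝ} (ha : 0 < a) (hm : 0 < m2)
    {α γ : ℝ} (hα : 0 ≤ α) (hγ : 0 < γ) (hαγ : α + γ ≤ 1) (b : Tor M) (x y : Tor (fine (L ^ k) M))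
    (x' y' : Tor (fine (L ^ n * L ^ k) M)) (hx : ∀ μ, (x μ).val = (x' μ).val / L ^ n)
    (hy : ∀ μ, (y μ).val = (y' μ).val / L ^ n) :
    |(holdist (L ^ n * L ^ k) M x' y') ^ (-α)
        * (minimiser (L ^ n * L ^ k) M (aK a L (k + n)) (((L ^ n * L ^ k : ℕ) : ℝ) ^ 2) m2 (Pi.single b 1) x'
          - minimiser (L ^ n * L ^ k) M (aK a L (k + n)) (((L ^ n * L ^ k : ℕ) : ℝ) ^ 2) m2 (Pi.single b 1) y')
      - (holdist (L ^ k) M x y) ^ (-α)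
        * (minimiser (L ^ k) M (aK a L k) (((L ^ k : ℕ) : ℝ) ^ 2) m2 (Pi.single b 1) x
          - minimiser (L ^ k) M (aK a L k) (((L ^ k : ℕ) : ℝ) ^ 2) m2 (Pi.single b 1) y)|
      ≤ (fprop38RateConst a a (lemma43Const a L k n) ((π ^ 2 / 4) ^ d) d γ α (2 * (d : ℝ) ^ α) 0
          + fprop38PosConst a ((π ^ 2 / 4) ^ d) d γ α (2 * (d : ℝ) ^ α) (6 * (d : ℝ) ^ (α + γ)))
        * ((L ^ k : ℕ) : ℝ) ^ (-γ) := by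
  haveI : NeZero (L ^ n) := ⟨pow_ne_zero _ (NeZero.ne L)⟩
  have hLr : (1 : ℝ) < L := by exact_mod_cast (lt_of_lt_of_le one_lt_two hL)
  have hNodd : Odd (L ^ k) := hLodd.pow
  have hN'odd : Odd (L ^ n * L ^ k) := (hLodd.pow).mul hNodd
  have hN1 : 1 ≤ L ^ k := Nat.one_le_pow _ _ (by omega)
  have hR1 : 1 ≤ L ^ n := Nat.one_le_pow _ _ (by omega)
  have hN'1 : 1 ≤ L ^ n * L ^ k := Nat.one_le_iff_ne_zero.mpr (mul_ne_zero (by omega) (by omega))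
  have hNr : (0 : ℝ) < ((L ^ k : ℕ) : ℝ) := by exact_mod_cast (show 0 < L ^ k by omega)
  have haA : 0 < aK a L k := aK_pos ha hLr hk
  have haB : 0 < aK a L (k + n) := aK_pos ha hLr (by omega)
  have hα1 : α ≤ 1 := by linarith
  -- the digit sums
  have hA := holder_kernel_eq_digitSum (L ^ k) M hNodd hN1 haA hm α b x y
  have hB := holder_kernel_eq_digitSum (L ^ n * L ^ k) M hN'odd hN'1 haB hm α b x' y'
  -- the factor bounds at the alias momenta
  have hρ := holdist_nonneg (L ^ k) M x y
  have hρ' := holdist_nonneg (L ^ n * L ^ k) M x' y'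
  have hEB : ∀ (q : Tor M) (w : Fin d → ℤ),
      ‖holderFac α (holdist (L ^ n * L ^ k) M x' y') (urep (L ^ n * L ^ k) M x' y') (aliasPt (sOf M q) w)‖
        ≤ 2 * (d : ℝ) ^ α * ‖aliasPt (sOf M q) w‖ ^ α :=
    fun q w => norm_holderFac_le hα hα1 (norm_urep_le _ M x' y') _
  have hEd : ∀ (q : Tor M) (w : Fin d → ℤ),
      ‖holderFac α (holdist (L ^ n * L ^ k) M x' y') (urep (L ^ n * L ^ k) M x' y') (aliasPt (sOf M q) w)
          - holderFac α (holdist (L ^ k) M x y) (urep (L ^ k) M x y) (aliasPt (sOf M q) w)‖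
        ≤ (0 * ((L ^ k : ℕ) : ℝ) ^ (-γ) + 6 * (d : ℝ) ^ (α + γ) * ((((L ^ k : ℕ) : ℝ))⁻¹) ^ γ)
          * ‖aliasPt (sOf M q) w‖ ^ (α + γ) := by
    intro q w
    have h := norm_holderFac_sub_le hα hγ hαγ hρ hρ' (inv_pos.mpr hNr)
      (abs_holdist_sub_le (L ^ k) (L ^ n) M x y x' y' hx hy) (norm_urep_le _ M x y) (norm_urep_le _ M x' y')
      (aliasPt (sOf M q) w) (cexp_dot_urepOver (L ^ k) (L ^ n) M q w x y x' y')
      (norm_urepOver_sub_le (L ^ k) (L ^ n) M x y x' y' hx hy)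
    refine h.trans (le_of_eq ?_)
    ring
  have h := factor_two_spacing_torus hd hLodd hL hk hn M ha hm hγ.le (by linarith) hα (by linarith) b
    (ξ := upos (L ^ k) M x) (ξ' := upos (L ^ n * L ^ k) M x') (abs_upos_sub_le hN1 hR1 M x x' hx)
    (holderFac α (holdist (L ^ k) M x y) (urep (L ^ k) M x y))
    (holderFac α (holdist (L ^ n * L ^ k) M x' y') (urep (L ^ n * L ^ k) M x' y'))
    (by positivity) le_rfl (by positivity) hEB hEd hA hB
  exact h

/-- **KING'S PROPOSITION 3.8, FOURTH LINE OF (3.71), ON THE TORUS, SUP-NORM FORM, FOR THE ACTUAL OPERATORS** — the Hölder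
quotient of the LATTICE DERIVATIVE: with `∂^η_μℋ(x, b) = η⁻¹(ℋ(x + e_μ, b) − ℋ(x, b))`, for `x′, y′` over `x, y`, every `b`,
`μ`, `0 ≤ α`, `0 < γ`, `α + γ < 1` (King's «α + γ < 1»):
`||x′ − y′|^{−α}(∂^{η′}_μℋ_{k+n}(x′,b) − ∂^{η′}_μℋ_{k+n}(y′,b)) − |x − y|^{−α}(∂^η_μℋ_k(x,b) − ∂^η_μℋ_k(y,b))| ≤ (C₁ + C₂)·L^{−γk}`,
`C₁ = fprop38RateConst a a θ (π²∕4)^d d γ (α+1) (2d^α) (2d^α2^{1−γ})`, `C₂ = fprop38PosConst a (π²∕4)^d d γ (α+1) (2d^α)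
(6d^{α+γ})`. [cite: King1986, Prop. 3.8 (3.71) p.664; (4.19), (4.22)–(4.28) pp.672–673] -/
theorem king_prop38_holder_deriv_torus (hd : 0 < d) {L : ℕ} [NeZero L] (hLodd : Odd L) (hL : 2 ≤ L) {k n : ℕ}
    (hk : 1 ≤ k) (hn : 1 ≤ n) (M : Fin d → ℕ) [hM : ∀ μ, NeZero (M μ)] {a m2 : ℝ} (ha : 0 < a) (hm : 0 < m2)
    {α γ : ℝ} (hα : 0 ≤ α) (hγ : 0 < γ) (hαγ : α + γ < 1) (b : Tor M) (x y : Tor (fine (L ^ k) M))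
    (x' y' : Tor (fine (L ^ n * L ^ k) M)) (hx : ∀ μ, (x μ).val = (x' μ).val / L ^ n)
    (hy : ∀ μ, (y μ).val = (y' μ).val / L ^ n) (μ : Fin d) :
    |(holdist (L ^ n * L ^ k) M x' y') ^ (-α)
        * (((L ^ n * L ^ k : ℕ) : ℝ)
            * (minimiser (L ^ n * L ^ k) M (aK a L (k + n)) (((L ^ n * L ^ k : ℕ) : ℝ) ^ 2) m2 (Pi.single b 1)
                (x' + unitVec (fine (L ^ n * L ^ k) M) μ)
              - minimiser (L ^ n * L ^ k) M (aK a L (k + n)) (((L ^ n * L ^ k : ℕ) : ℝ) ^ 2) m2 (Pi.single b 1) x')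
          - ((L ^ n * L ^ k : ℕ) : ℝ)
            * (minimiser (L ^ n * L ^ k) M (aK a L (k + n)) (((L ^ n * L ^ k : ℕ) : ℝ) ^ 2) m2 (Pi.single b 1)
                (y' + unitVec (fine (L ^ n * L ^ k) M) μ)
              - minimiser (L ^ n * L ^ k) M (aK a L (k + n)) (((L ^ n * L ^ k : ℕ) : ℝ) ^ 2) m2 (Pi.single b 1) y'))
      - (holdist (L ^ k) M x y) ^ (-α)
        * (((L ^ k : ℕ) : ℝ)
            * (minimiser (L ^ k) M (aK a L k) (((L ^ k : ℕ) : ℝ) ^ 2) m2 (Pi.single b 1) (x + unitVec (fine (L ^ k) M) μ)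
              - minimiser (L ^ k) M (aK a L k) (((L ^ k : ℕ) : ℝ) ^ 2) m2 (Pi.single b 1) x)
          - ((L ^ k : ℕ) : ℝ)
            * (minimiser (L ^ k) M (aK a L k) (((L ^ k : ℕ) : ℝ) ^ 2) m2 (Pi.single b 1) (y + unitVec (fine (L ^ k) M) μ)
              - minimiser (L ^ k) M (aK a L k) (((L ^ k : ℕ) : ℝ) ^ 2) m2 (Pi.single b 1) y))|
      ≤ (fprop38RateConst a a (lemma43Const a L k n) ((π ^ 2 / 4) ^ d) d γ (α + 1) (2 * (d : ℝ) ^ α)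
            (2 * (d : ℝ) ^ α * 2 ^ (1 - γ))
          + fprop38PosConst a ((π ^ 2 / 4) ^ d) d γ (α + 1) (2 * (d : ℝ) ^ α) (6 * (d : ℝ) ^ (α + γ)))
        * ((L ^ k : ℕ) : ℝ) ^ (-γ) := by
  haveI : NeZero (L ^ n) := ⟨pow_ne_zero _ (NeZero.ne L)⟩
  have hLr : (1 : ℝ) < L := by exact_mod_cast (lt_of_lt_of_le one_lt_two hL)
  have hNodd : Odd (L ^ k) := hLodd.pow
  have hN'odd : Odd (L ^ n * L ^ k) := (hLodd.pow).mul hNodd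
  have hN1 : 1 ≤ L ^ k := Nat.one_le_pow _ _ (by omega)
  have hR1 : 1 ≤ L ^ n := Nat.one_le_pow _ _ (by omega)
  have hN'1 : 1 ≤ L ^ n * L ^ k := Nat.one_le_iff_ne_zero.mpr (mul_ne_zero (by omega) (by omega))
  have hNr : (0 : ℝ) < ((L ^ k : ℕ) : ℝ) := by exact_mod_cast (show 0 < L ^ k by omega)
  have hRr : (1 : ℝ) ≤ ((L ^ n : ℕ) : ℝ) := by exact_mod_cast hR1
  have haA : 0 < aK a L k := aK_pos ha hLr hk
  have haB : 0 < aK a L (k + n) := aK_pos ha hLr (by omega)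
  have hα1 : α ≤ 1 := by linarith
  have hηB : 0 < (((L ^ n * L ^ k : ℕ) : ℝ))⁻¹ := by positivity
  have hηBA : (((L ^ n * L ^ k : ℕ) : ℝ))⁻¹ ≤ (((L ^ k : ℕ) : ℝ))⁻¹ := by
    rw [Nat.cast_mul, mul_inv]
    exact mul_le_of_le_one_left (inv_nonneg.mpr hNr.le) (inv_le_one_of_one_le₀ hRr)
  -- the digit sums
  have hA := holder_dkernel_eq_digitSum (L ^ k) M hNodd hN1 haA hm α b x y μ
  have hB := holder_dkernel_eq_digitSum (L ^ n * L ^ k) M hN'odd hN'1 haB hm α b x' y' μ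
  -- the factor bounds at the alias momenta
  have hρ := holdist_nonneg (L ^ k) M x y
  have hρ' := holdist_nonneg (L ^ n * L ^ k) M x' y'
  have hEB : ∀ (q : Tor M) (w : Fin d → ℤ),
      ‖fdq (((L ^ n * L ^ k : ℕ) : ℝ))⁻¹ (-(aliasPt (sOf M q) w μ))
          * holderFac α (holdist (L ^ n * L ^ k) M x' y') (urep (L ^ n * L ^ k) M x' y') (aliasPt (sOf M q) w)‖
        ≤ 2 * (d : ℝ) ^ α * ‖aliasPt (sOf M q) w‖ ^ (α + 1) :=
    fun q w => norm_fdq_mul_holderFac_le hηB hα hα1 (norm_urep_le _ M x' y') _ μ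
  have hEd : ∀ (q : Tor M) (w : Fin d → ℤ),
      ‖fdq (((L ^ n * L ^ k : ℕ) : ℝ))⁻¹ (-(aliasPt (sOf M q) w μ))
            * holderFac α (holdist (L ^ n * L ^ k) M x' y') (urep (L ^ n * L ^ k) M x' y') (aliasPt (sOf M q) w)
          - fdq (((L ^ k : ℕ) : ℝ))⁻¹ (-(aliasPt (sOf M q) w μ))
            * holderFac α (holdist (L ^ k) M x y) (urep (L ^ k) M x y) (aliasPt (sOf M q) w)‖
        ≤ (2 * (d : ℝ) ^ α * 2 ^ (1 - γ) * ((L ^ k : ℕ) : ℝ) ^ (-γ)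
            + 6 * (d : ℝ) ^ (α + γ) * ((((L ^ k : ℕ) : ℝ))⁻¹) ^ γ) * ‖aliasPt (sOf M q) w‖ ^ (α + 1 + γ) := by
    intro q w
    exact norm_fdq_mul_holderFac_sub_le hNr hηB hηBA hα hγ hαγ.le hρ hρ' (inv_pos.mpr hNr)
      (abs_holdist_sub_le (L ^ k) (L ^ n) M x y x' y' hx hy) (norm_urep_le _ M x y) (norm_urep_le _ M x' y')
      (aliasPt (sOf M q) w) (cexp_dot_urepOver (L ^ k) (L ^ n) M q w x y x' y')
      (norm_urepOver_sub_le (L ^ k) (L ^ n) M x y x' y' hx hy) μ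
  have h := factor_two_spacing_torus hd hLodd hL hk hn M ha hm hγ.le (by linarith) (by linarith : 0 ≤ α + 1)
    (by linarith : α + 1 + γ < 2) b
    (ξ := upos (L ^ k) M x) (ξ' := upos (L ^ n * L ^ k) M x') (abs_upos_sub_le hN1 hR1 M x x' hx)
    (fun Q => fdq (((L ^ k : ℕ) : ℝ))⁻¹ (-(Q μ)) * holderFac α (holdist (L ^ k) M x y) (urep (L ^ k) M x y) Q)
    (fun Q => fdq (((L ^ n * L ^ k : ℕ) : ℝ))⁻¹ (-(Q μ))
      * holderFac α (holdist (L ^ n * L ^ k) M x' y') (urep (L ^ n * L ^ k) M x' y') Q)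
    (by positivity) (by positivity) (by positivity) hEB hEd hA hB
  exact h

end Torus

end Literature.MathematicalPhysics.QuantumFieldTheory.King1986
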